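import Mathlib

/-!
# GridStability/Models/InverterDroop — droop-controlled grid-forming inverter: the printed reduced models

Cell `gridfusion` (LADDER-GRIDFUSION, rung G3 «inverter models», seat model-3). THREE COLUMNS. Everything in this file is the MODELLED column: definitions of reduced models of a
droop-controlled («grid-forming») voltage-source converter connected to an infinite bus, typed AS
PRINTED with equation locators. Nothing here says that any converter, grid or device is stable; a
later certificate about one of these vector fields is a statement about the MODEL named in its
docstring (perturbation class and domain stated there), and the model's fidelity is a separate,
cited, VALIDATED claim (plan/MODEL-VALIDITY.md, rows requested from model-2 as MV-INV-*).

## Sources (read on the page this session; tags are the printed equation numbers)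

* [cite: Qoria2020] T. Qoria, *Grid-forming control to achieve a 100 % power electronics interfaced
  power transmission systems*, PhD thesis, HESAM/ENSAM 2020 (HAL tel-03078479): Ch. II eqs.
  (II-30)–(II-33) (quasi-static active/reactive power of a voltage source `V_m∠δ_m` behind
  `R_c + jX_c` feeding `V_g∠0`); Ch. III eq. (III-46) («Strategy C»: p–f droop through a first-order
  low-pass filter of cut-off `ω_c`, droop gain `k_i`, no PLL:
  `(ω_b/(k_i ω_c)) dω_m/dt = p* − p_vsc − (ω_b/k_i)(ω_m − ω_set)`), eqs. (III-20)–(III-22)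
  (identification with a virtual synchronous machine, `H = ω_b/(2 ω_c k_i)`); Ch. V eqs.
  (V-13)–(V-14) (`p_mes = P_max sin δ_m`, `P_max = V_m V_e/(X_c + X_g)`), (V-17) (frequency during a
  bolted fault), (V-22)–(V-23) (current-saturated branch `p_mes = I_maxSAT V_e cos δ_m`),
  (V-26)–(V-28) (fault-on angle and critical clearing times).
* [cite: HenriquezAuba2022] R. Henriquez-Auba, *Challenges on Decarbonization of Electric Power
  Systems*, PhD thesis, UC Berkeley, Tech. Rep. UCB/EECS-2022-264 (2022), §2.5 eqs. (2.58a)–(2.58e)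
  (droop outer control with low-pass filtered power measurements) and the Remark after eq. (2.9)
  («the traditional power-frequency droop control with a low-pass filter … has the same steady-state
  response with the VSM model if `M = 1/(ω_z k_p)`»).
* [cite: SchifferEtAl2014] J. Schiffer, R. Ortega, A. Astolfi, J. Raisch, T. Sezi, Automatica 50
  (2014) §3, Remark 3.3: «the dynamics of an inverter with frequency droop control and the swing
  equation dynamics of an SG are equivalent».
* [cite: HeidariSeronBraslavsky2014] R. Heidari, M. Seron, J. Braslavsky, AUCC 2014
  (arXiv:1409.4639) §2 eq. (1): filter-less («first-order») droop `d_i θ̇_i = P_i* − P_{e,i}`.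

## What is typed

§1 the quasi-static power–angle maps; §2 the droop outer loop (2.58a)–(2.58e) as printed
(states `θ, p_f, q_f`, measured powers as inputs); §3 the closed two-state reduced model
«droop inverter – infinite bus» obtained from (III-46) with the quasi-static power (V-13)
(states `δ` [rad], `ω` [pu], time in seconds), its equilibria, the swing-equation identification
(III-21)–(III-22), the first-order (filter-less) limit, and the current-saturated branch (V-22);
§4 the exact change of variables behind the droop ≡ VSM remark of [HenriquezAuba2022]; §5 the
POLYNOMIALISED form of §3 in the variables `(s, c, ω) = (sin δ, cos δ, ω)` with the algebraic
constraint `s² + c² = 1`, and the exact embedding lemma (every solution of §3 yields a solution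
of the polynomial system on the constraint set) — this is the object an SOS certificate quantifies
over (PARTITION §0, I2).

## Deliberately NOT here

Inner loops, virtual impedance, LC(L)-filter / line / dc-side dynamics ([cite: HenriquezAuba2022]
(2.10)–(2.23)), PLL, VSM, dVOC (files `InverterPLL`, `InverterVSM`, `InverterDVOC`); the current
limiter as a SWITCHED system (only its two printed power–angle branches are typed; census in
models/MODEL-3-NOTES.md). No parameter values: benchmark data are model-4's custody.
-/

noncomputable section

open Real

namespace Summit.Ventures.GridStability.Models.InverterDroop

/-! ## §1 Quasi-static power–angle maps of a voltage source behind an impedance -/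

/-- Active power delivered by the modulated voltage `V_m∠δ_m` to the grid voltage `V_g∠0` through
`R_c + jX_c`, AS PRINTED [cite: Qoria2020, eq. (II-30)]:
`p_ac = V_g/(R_c² + X_c²) · [R_c (V_m cos δ_m − V_g) + X_c V_m sin δ_m]` (per unit).
MODELLED: quasi-static (phasor) network, balanced three-phase, fundamental frequency only. -/
def pLossy (Vm Vg Rc Xc δ : ℝ) : ℝ :=
  Vg / (Rc ^ 2 + Xc ^ 2) * (Rc * (Vm * cos δ - Vg) + Xc * Vm * sin δ)

/-- Reactive power companion of `pLossy`, AS PRINTED [cite: Qoria2020, eq. (II-31)]: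
`q_ac = V_g/(R_c² + X_c²) · [−R_c V_m sin δ_m + X_c (V_g − V_m cos δ_m)]`.
MODELLED: as `pLossy`. -/
def qLossy (Vm Vg Rc Xc δ : ℝ) : ℝ :=
  Vg / (Rc ^ 2 + Xc ^ 2) * (-(Rc * Vm * sin δ) + Xc * (Vg - Vm * cos δ))

/-- Active power over a purely inductive coupling reactance `X`, AS PRINTED
[cite: Qoria2020, eq. (II-32)] `p_ac = (V_m V_g/(L_c ω_g)) sin δ_m`, and [cite: Qoria2020, eqs.
(V-13)–(V-14)] `p_mes = P_max sin δ_m`, `P_max = V_m V_e/(X_c + X_g)` (converter reactance plus grid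
reactance up to the infinite bus `V_e`). MODELLED: resistances neglected (`X ≫ R`). -/
def pInductive (Vm Vg X δ : ℝ) : ℝ :=
  Vm * Vg / X * sin δ

/-- Reactive power over a purely inductive coupling, AS PRINTED [cite: Qoria2020, eq. (II-33)]:
`q_ac = V_m (V_m − V_g cos δ_m)/(L_c ω_g)`. -/
def qInductive (Vm Vg X δ : ℝ) : ℝ :=
  Vm * (Vm - Vg * cos δ) / X

/-- Active power of the converter while its current is clamped at the magnitude `I_maxSAT` with the
current aligned on the d-axis, AS PRINTED [cite: Qoria2020, eqs. (V-22)–(V-23)]: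
`p_mes = P_max3 cos δ_m`, `P_max3 = I_maxSAT V_e`. MODELLED: saturated branch of the current
saturation algorithm only; which branch is active is decided by `|i| ≥ I_maxSAT` (not typed here). -/
def pSaturated (Imax Ve δ : ℝ) : ℝ :=
  Imax * Ve * cos δ

/-- The lossy map (II-30) reduces to the inductive map (II-32) when `R_c = 0`. -/
theorem pLossy_eq_pInductive (Vm Vg Xc δ : ℝ) (hX : Xc ≠ 0) :
    pLossy Vm Vg 0 Xc δ = pInductive Vm Vg Xc δ := by
  unfold pLossy pInductive
  field_simp
  ring

/-- PROVENANCE NOTE. At `R_c = 0` the printed (II-31) gives the reactive power at the GRID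
terminal, `V_g (V_g − V_m cos δ_m)/X_c`, whereas the printed (II-33) `qInductive` is the value at the
CONVERTER terminal, `V_m (V_m − V_g cos δ_m)/X_c` ([cite: Qoria2020] derives (II-32)–(II-33) «from
(II-30), (II-31)» without flagging the change of terminal; the two agree for the active power,
`pLossy_eq_pInductive`, not for the reactive power). Both are kept, as printed. -/
theorem qLossy_Rc_zero (Vm Vg Xc δ : ℝ) (hX : Xc ≠ 0) :
    qLossy Vm Vg 0 Xc δ = Vg * (Vg - Vm * cos δ) / Xc := by
  unfold qLossy
  field_simp
  ring

/-- The maximum transferable power `P_max = V_m V_e/(X_c + X_g)` of [cite: Qoria2020, eq. (V-14)]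
is the coefficient of `pInductive` with `X = X_c + X_g`. -/
theorem pInductive_eq_pmax_mul_sin (Vm Ve Xc Xg δ : ℝ) :
    pInductive Vm Ve (Xc + Xg) δ = Vm * Ve / (Xc + Xg) * sin δ := rfl

/-! ## §2 Droop outer control with low-pass filtered power measurements (as printed) -/

/-- Parameters of the droop outer loop of a grid-forming VSC, [cite: HenriquezAuba2022, eqs.
(2.58a)–(2.58e)]: base frequency `Ω_b` [rad/s], grid SRF speed `ω_s` [pu], measurement low-pass
cut-off `ω_z` [rad/s], `p–ω` droop gain `k_p`, `q–v` droop gain `k_q`, set-points `ω*, v*, p*, q*`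
[pu]. No numeric values here (model-4 custody). -/
structure DroopOuterLoop where
  /-- base angular frequency `Ω_b` [rad/s] -/
  Ωb : ℝ
  /-- angular speed `ω_s` of the grid reference frame [pu] -/
  ωs : ℝ
  /-- cut-off `ω_z` of the first-order power-measurement filters [rad/s] -/
  ωz : ℝ
  /-- active-power/frequency droop gain `k_p` [pu/pu] -/
  kp : ℝ
  /-- reactive-power/voltage droop gain `k_q` [pu/pu] -/
  kq : ℝ
  /-- frequency set-point `ω*` [pu] -/
  ωref : ℝ
  /-- voltage set-point `v*` [pu] -/
  vref : ℝ
  /-- active-power set-point `p*` [pu] -/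
  pref : ℝ
  /-- reactive-power set-point `q*` [pu] -/
  qref : ℝ

namespace DroopOuterLoop

variable (L : DroopOuterLoop)

/-- Frequency command `ω_oc = ω* + k_p (p* − p_f)` [cite: HenriquezAuba2022, eq. (2.58d)]. -/
def omegaOc (pf : ℝ) : ℝ := L.ωref + L.kp * (L.pref - pf)

/-- Voltage command `v_oc^{d,*} = v* + k_q (q* − q_f)` [cite: HenriquezAuba2022, eq. (2.58e)]. -/
def voc (qf : ℝ) : ℝ := L.vref + L.kq * (L.qref - qf)

/-- Angle equation `θ̇ = Ω_b (ω_oc − ω_s)` [cite: HenriquezAuba2022, eq. (2.58a)] (`θ` = angle of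
the converter SRF relative to the grid SRF, rad; time in seconds). -/
def dθ (pf : ℝ) : ℝ := L.Ωb * (L.omegaOc pf - L.ωs)

/-- Filtered active power `ṗ_f = ω_z (p_e − p_f)` [cite: HenriquezAuba2022, eq. (2.58b)];
`p_e` = measured active power (an input of the outer loop). -/
def dpf (pe pf : ℝ) : ℝ := L.ωz * (pe - pf)

/-- Filtered reactive power `q̇_f = ω_z (q_e − q_f)` [cite: HenriquezAuba2022, eq. (2.58c)]. -/
def dqf (qe qf : ℝ) : ℝ := L.ωz * (qe - qf)

end DroopOuterLoop

/-! ## §3 The reduced model «droop-controlled converter – infinite bus» (two states) -/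

/-- Parameters of the reduced large-signal model of a droop-controlled («Strategy C», no PLL)
converter behind its output reactance, connected to an infinite bus, [cite: Qoria2020, eq. (III-46)
with (V-13)–(V-14)]: base frequency `ω_b` [rad/s], low-pass cut-off `ω_c` [rad/s], droop gain
`k_i` (written `m_p` in (V-27)), set-point `p*` [pu], `P_max = V_m V_e/(X_c+X_g)` [pu], frequency
set-point `ω_set` [pu] and infinite-bus frequency `ω_e` [pu]. MODELLED: inner loops, filter and
line dynamics quasi-static; voltage magnitudes constant; no current limitation (see `dωSat`). -/
structure ReducedParams where
  /-- base angular frequency `ω_b` [rad/s] -/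
  ωb : ℝ
  /-- cut-off `ω_c` of the active-power low-pass filter [rad/s] -/
  ωc : ℝ
  /-- droop («inverse droop») gain `k_i` [pu frequency per pu power] -/
  ki : ℝ
  /-- active-power set-point `p*` [pu] -/
  pref : ℝ
  /-- maximum transferable power `P_max` [pu] -/
  Pmax : ℝ
  /-- frequency set-point `ω_set` of the control [pu] -/
  ωset : ℝ
  /-- frequency `ω_e` of the infinite bus [pu] -/
  ωe : ℝ

namespace ReducedParams

variable (P : ReducedParams)

/-- Angle equation `δ̇_m = ω_b (ω_m − ω_e)`: the control angle is `ω_b ∫ ω_m dt` (the factor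
`ω_b/s` of [cite: Qoria2020, eq. (III-47)]) and `δ_m` is measured against the infinite bus rotating
at `ω_e` (pu); consistent with the fault-on rate `m_p ω_b p*` in [cite: Qoria2020, eq. (V-27)]. -/
def dδ (_δ ω : ℝ) : ℝ := P.ωb * (ω - P.ωe)

/-- Frequency equation of «Strategy C» solved for `dω_m/dt`, for a GIVEN power–angle map `p`:
from [cite: Qoria2020, eq. (III-46)] `(ω_b/(k_i ω_c)) dω_m/dt = p* − p_vsc − (ω_b/k_i)(ω_m − ω_set)`. -/
def dωOf (p : ℝ → ℝ) (δ ω : ℝ) : ℝ :=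
  P.ki * P.ωc / P.ωb * (P.pref - p δ - P.ωb / P.ki * (ω - P.ωset))

/-- Frequency equation of the reduced model in normal (unsaturated) operation: `dωOf` with the
quasi-static power `p_vsc = P_max sin δ_m` [cite: Qoria2020, eqs. (III-46), (V-13)]. -/
def dω (δ ω : ℝ) : ℝ := P.dωOf (fun θ => P.Pmax * sin θ) δ ω

/-- Frequency equation on the current-saturated branch: `dωOf` with `p_mes = I_maxSAT V_e cos δ_m`
[cite: Qoria2020, eqs. (III-46), (V-22)–(V-23)]. MODELLED: valid only while the limiter is active. -/
def dωSat (Imax Ve : ℝ) (δ ω : ℝ) : ℝ := P.dωOf (fun θ => Imax * Ve * cos θ) δ ω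

/-- A (classical) solution of the reduced model on the whole time axis: `δ, ω : ℝ → ℝ` with
`δ' = dδ`, `ω' = dω` everywhere. -/
structure IsSolution (δ ω : ℝ → ℝ) : Prop where
  /-- the angle equation holds at every time -/
  angle : ∀ t, HasDerivAt δ (P.dδ (δ t) (ω t)) t
  /-- the frequency equation holds at every time -/
  freq : ∀ t, HasDerivAt ω (P.dω (δ t) (ω t)) t

/-- Equilibrium of the reduced model: both right-hand sides vanish. -/
structure IsEquilibrium (δ ω : ℝ) : Prop where
  /-- `dδ = 0` -/
  dδ_eq : P.dδ δ ω = 0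
  /-- `dω = 0` -/
  dω_eq : P.dω δ ω = 0

/-- Virtual inertia constant `M = ω_b/(k_i ω_c)` (= `2H`, `H = ω_b/(2 ω_c k_i)`) of the swing-equation
reading of «Strategy C» [cite: Qoria2020, eqs. (III-21)–(III-22)]. -/
def inertia : ℝ := P.ωb / (P.ki * P.ωc)

/-- Damping / inverse-droop coefficient `ω_b/k_i` multiplying `(ω_m − ω_set)` in
[cite: Qoria2020, eqs. (III-21), (III-46)]. -/
def damping : ℝ := P.ωb / P.ki

/-- **Swing-equation form** [cite: Qoria2020, eqs. (III-21)–(III-22)], [cite: SchifferEtAl2014,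
Remark 3.3]: `M · dω_m/dt = p* − P_max sin δ_m − (ω_b/k_i)(ω_m − ω_set)` with `M = ω_b/(k_i ω_c)`,
i.e. the reduced droop model IS the classical single-machine swing equation with mechanical power
`p*`, inertia `M` and damping `ω_b/k_i` (an identity between vector fields, no approximation). -/
theorem inertia_mul_dω (hb : P.ωb ≠ 0) (hi : P.ki ≠ 0) (hc : P.ωc ≠ 0) (δ ω : ℝ) :
    P.inertia * P.dω δ ω = P.pref - P.Pmax * sin δ - P.damping * (ω - P.ωset) := by
  unfold inertia dω dωOf damping
  field_simp

/-- The same identity for an arbitrary power–angle map (covers the saturated branch `dωSat`). -/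
theorem inertia_mul_dωOf (hb : P.ωb ≠ 0) (hi : P.ki ≠ 0) (hc : P.ωc ≠ 0) (p : ℝ → ℝ) (δ ω : ℝ) :
    P.inertia * P.dωOf p δ ω = P.pref - p δ - P.damping * (ω - P.ωset) := by
  unfold inertia dωOf damping
  field_simp

/-- Equilibria: if the set-point frequency equals the bus frequency and `P_max sin δ_s = p*`
(operating points (a), (a′) of [cite: Qoria2020, eqs. (V-15)–(V-16)]: `δ_0 = arcsin(p*/P_max)`,
`δ_max = π − δ_0`), then `(δ_s, ω_e)` is an equilibrium of the reduced model. -/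
theorem isEquilibrium_of_sin_eq (δs : ℝ) (hω : P.ωset = P.ωe) (hp : P.Pmax * sin δs = P.pref) :
    P.IsEquilibrium δs P.ωe := by
  refine ⟨?_, ?_⟩
  · simp [dδ]
  · simp [dω, dωOf, hω, hp]

/-- Conversely, at an equilibrium with `ω_b ≠ 0` the frequency is the bus frequency. -/
theorem omega_eq_of_isEquilibrium (hb : P.ωb ≠ 0) {δ ω : ℝ} (h : P.IsEquilibrium δ ω) :
    ω = P.ωe := by
  have h1 := h.dδ_eq
  unfold dδ at h1
  rcases mul_eq_zero.mp h1 with h | h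
  · exact absurd h hb
  · linarith

/-- At an equilibrium with `ω_set = ω_e` (and nonzero gains) the power balance `P_max sin δ = p*`
holds [cite: Qoria2020, eq. (V-15)]. -/
theorem power_balance_of_isEquilibrium (hb : P.ωb ≠ 0) (hi : P.ki ≠ 0) (hc : P.ωc ≠ 0)
    (hω : P.ωset = P.ωe) {δ ω : ℝ} (h : P.IsEquilibrium δ ω) : P.Pmax * sin δ = P.pref := by
  have hωe : ω = P.ωe := P.omega_eq_of_isEquilibrium hb h
  have h2 : P.inertia * P.dω δ ω = 0 := by rw [h.dω_eq, mul_zero]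
  rw [P.inertia_mul_dω hb hi hc, hωe, hω, sub_self, mul_zero, sub_zero] at h2
  linarith

/-- Filter-less («first-order») droop: with `ω_c → ∞` the frequency follows the droop law
instantaneously, `ω_m = ω_set + (k_i/ω_b)(p* − p_mes)` (cf. [cite: Qoria2020, eq. (V-17)] during
a bolted fault, `p_mes = 0`), so the angle obeys the single equation
`δ̇_m = ω_b(ω_set − ω_e) + k_i (p* − P_max sin δ_m)`; this is the non-uniform-Kuramoto form
`d_i θ̇_i = P_i* − P_{e,i}` of [cite: HeidariSeronBraslavsky2014, eq. (1)] with `d = 1/k_i`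
(one inverter against a bus). -/
def dδFirstOrder (δ : ℝ) : ℝ := P.ωb * (P.ωset - P.ωe) + P.ki * (P.pref - P.Pmax * sin δ)

/-- The first-order droop law in the printed `d θ̇ = P* − P_e` shape (`d = 1/k_i`,
`ω_set = ω_e`) [cite: HeidariSeronBraslavsky2014, eq. (1)]. -/
theorem inv_ki_mul_dδFirstOrder (hi : P.ki ≠ 0) (hω : P.ωset = P.ωe) (δ : ℝ) :
    1 / P.ki * P.dδFirstOrder δ = P.pref - P.Pmax * sin δ := by
  unfold dδFirstOrder
  rw [hω, sub_self, mul_zero, zero_add]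
  field_simp

/-- Fault-on dynamics: during a bolted fault `p_mes = 0`, the first-order model gives the constant
rate `δ̇ = ω_b(ω_set − ω_e) + k_i p*`; with `ω_set = ω_e` this is the slope behind the linear
fault-on angle `δ(t) = δ_0 + (slope)·t` of [cite: Qoria2020, eqs. (V-26)–(V-27)] (printed there as
`k_i p* t`, resp. with the factor `m_p ω_b p*` in the clearing-time formula (V-27)). -/
theorem dδFirstOrder_fault (hω : P.ωset = P.ωe) (δ : ℝ) :
    ({ P with Pmax := 0 } : ReducedParams).dδFirstOrder δ = P.ki * P.pref := by
  simp [dδFirstOrder, hω]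

end ReducedParams

/-! ## §4 Droop with filter ≡ VSM: the exact change of variables -/

namespace DroopOuterLoop

variable (L : DroopOuterLoop)

/-- **Droop-with-filter is a VSM in the variable `ω_oc`** ([cite: HenriquezAuba2022], Remark after
eq. (2.9); [cite: SchifferEtAl2014], Remark 3.3): along any signal `p_e`, if `p_f` obeys the filter
equation (2.58b) then the frequency command `ω_oc = ω* + k_p(p* − p_f)` of (2.58d) obeys
`ω̇_oc = k_p ω_z (p* − p_e) − ω_z (ω_oc − ω*)` — the VSM frequency equation
`ω̇ = (1/M)[(p* − p_e) + (1/k_p)(ω* − ω)]` of [cite: HenriquezAuba2022, eq. (2.59b)] with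
`M = 1/(ω_z k_p)` (see `vsm_rhs_eq`). Exact, for all signals, not only in steady state. -/
theorem hasDerivAt_omegaOc {pf pe : ℝ → ℝ} {t : ℝ}
    (hpf : HasDerivAt pf (L.dpf (pe t) (pf t)) t) :
    HasDerivAt (fun τ => L.omegaOc (pf τ))
      (L.kp * L.ωz * (L.pref - pe t) - L.ωz * (L.omegaOc (pf t) - L.ωref)) t := by
  have h : HasDerivAt (fun τ => L.ωref + L.kp * (L.pref - pf τ))
      (0 + L.kp * (0 - L.dpf (pe t) (pf t))) t :=
    (hasDerivAt_const t L.ωref).add (((hasDerivAt_const t L.pref).sub hpf).const_mul L.kp)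
  have he : (0 + L.kp * (0 - L.dpf (pe t) (pf t)))
      = L.kp * L.ωz * (L.pref - pe t) - L.ωz * (L.omegaOc (pf t) - L.ωref) := by
    simp only [dpf, omegaOc]
    ring
  rw [he] at h
  exact h

/-- The VSM right-hand side of [cite: HenriquezAuba2022, eq. (2.59b)] with `M = 1/(ω_z k_p)`
equals the right-hand side found in `hasDerivAt_omegaOc`. -/
theorem vsm_rhs_eq (hk : L.kp ≠ 0) (pe ω : ℝ) :
    1 / (1 / (L.ωz * L.kp)) * ((L.pref - pe) + 1 / L.kp * (L.ωref - ω))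
      = L.kp * L.ωz * (L.pref - pe) - L.ωz * (ω - L.ωref) := by
  field_simp
  ring

end DroopOuterLoop

/-! ## §5 Polynomialised form of the reduced model and the exact embedding -/

namespace ReducedParams

variable (P : ReducedParams)

/-- `s`-component of the polynomialised field: `ṡ = c · ω_b (ω − ω_e)` (chain rule on `s = sin δ`).
Polynomial of degree 2 in `(s, c, ω)`, coefficients rational in the parameters. -/
def dS (_s c ω : ℝ) : ℝ := c * (P.ωb * (ω - P.ωe))

/-- `c`-component of the polynomialised field: `ċ = −s · ω_b (ω − ω_e)` (chain rule on `c = cos δ`). -/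
def dC (s _c ω : ℝ) : ℝ := -(s * (P.ωb * (ω - P.ωe)))

/-- `ω`-component of the polynomialised field: (III-46) with `sin δ` replaced by the variable `s`:
`ω̇ = (k_i ω_c/ω_b) (p* − P_max s − (ω_b/k_i)(ω − ω_set))` — affine in `(s, ω)`. -/
def dΩ (s _c ω : ℝ) : ℝ := P.ki * P.ωc / P.ωb * (P.pref - P.Pmax * s - P.ωb / P.ki * (ω - P.ωset))

/-- The `ω`-component agrees with the trigonometric field under `s = sin δ` (by definition). -/
theorem dΩ_sin_cos (δ ω : ℝ) : P.dΩ (sin δ) (cos δ) ω = P.dω δ ω := rfl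

/-- **Exact embedding.** Every solution `(δ, ω)` of the reduced trigonometric model is carried by
`(s, c, ω) := (sin δ, cos δ, ω)` to a solution of the POLYNOMIAL system `(dS, dC, dΩ)` lying on
the constraint set `s² + c² = 1`. Hence an SOS Lyapunov certificate for the polynomial system on
`{s² + c² = 1} ∩ D` is a certificate for the reduced model on the corresponding angle domain
(sufficiency only; the embedding is not surjective onto off-circle states). -/
theorem embedding {δ ω : ℝ → ℝ} (h : P.IsSolution δ ω) (t : ℝ) :
    HasDerivAt (fun τ => sin (δ τ)) (P.dS (sin (δ t)) (cos (δ t)) (ω t)) t ∧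
    HasDerivAt (fun τ => cos (δ τ)) (P.dC (sin (δ t)) (cos (δ t)) (ω t)) t ∧
    HasDerivAt ω (P.dΩ (sin (δ t)) (cos (δ t)) (ω t)) t ∧
    sin (δ t) ^ 2 + cos (δ t) ^ 2 = 1 := by
  have hδ := h.angle t
  have hω := h.freq t
  refine ⟨?_, ?_, ?_, ?_⟩
  · have := hδ.sin
    simpa [dS, dδ] using this
  · have := hδ.cos
    simpa [dC, dδ, neg_mul] using this
  · simpa [dΩ_sin_cos] using hω
  · exact sin_sq_add_cos_sq (δ t)

/-- Equilibria of the polynomial system on the circle with `ω_set = ω_e`: `ω = ω_e` and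
`P_max s = p*` make all three components vanish (for any `c`). -/
theorem poly_equilibrium (hω : P.ωset = P.ωe) {s c : ℝ} (hs : P.Pmax * s = P.pref) :
    P.dS s c P.ωe = 0 ∧ P.dC s c P.ωe = 0 ∧ P.dΩ s c P.ωe = 0 := by
  refine ⟨?_, ?_, ?_⟩
  · simp [dS]
  · simp [dC]
  · simp [dΩ, hω, hs]

end ReducedParams

end Summit.Ventures.GridStability.Models.InverterDroop

end
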